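import Summits.SmoothPoincare4.SmoothPoincare4.Theorems.CylinderEntropyCylinderRungTwoKernelMassOfProduct
import Summits.SmoothPoincare4.SmoothPoincare4.Theorems.CylinderEntropyCylinderRungTwoKernelIntegralTendstoOfWeakLimit
import Literature.Geometry.Riemannian.SphericalCylinderEntropy
import Literature.Geometry.Riemannian.SphericalCylinderKernelCertificate
import Literature.Geometry.Riemannian.SphericalCylinderEntropySmallScales
import Literature.MeasureTheory.Hausdorff.SmoothImageHausdorffFinite
import HarnessLib

/-!
# Route `CylinderEntropy`, crux `CylinderRungTwo` (stmt-SmoothPoincare4-7631), line `killing-flux`: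
# a limit height of centres with unit lower density is an atom of weight `≥ vol(S⁴)` of the
# product limit measure (registered helper `helper_atomOfLiminfDensity`; lead c4, "relaxation up
# to multiplicity", worker A1')

Let `ι k : M⁴ → N = S⁴ × ℝ = {z ∈ ℝ⁶ | ∑_{i<5} zᵢ² = 1}` be smooth embeddings of a compact `4`-manifold
with heights `|z₅| ≤ B`, whose area measures `μH⁴ ⌊ range (ι k)` converge weakly (against bounded
continuous test functions on `ℝ⁶`) to a finite measure `μ` carried by the slab
`C = {∑_{i<5} zᵢ² = 1, |z₅| ≤ B}` and having the PRODUCT property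
`∫ Φ(z₅) g(z') dμ = vol⁻¹ (∫_{S⁴} g dμH⁴) ∫ Φ(z₅) dμ` (`vol = μH⁴(S⁴ ⊂ ℝ⁵)`).  Let `y k ∈ N` be centres
converging to `y₀`, at which the cross-sections have unit lower Gaussian density at every scale
`τ ∈ (0, 1]`: `1 ≤ liminf_k F̂_{y k, τ}(range (ι k))` (`F̂ = cylDensity`).  Then the limit height
`y₀ 5` carries an atom of `μ` of weight at least `vol`:

  `μH⁴(S⁴) ≤ μ {z | z₅ = (y₀)₅}`.

Proof.  Fix `τ ∈ (0, 1]`.  The typed kernel `K_{p,τ}` is `≥ 0` on `N` and bounded on `N × N`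
(`cylKernel_nonneg_of_mem`, `abs_cylKernel_le_majorant`), and `μH⁴(range (ι k)) < ∞`, so
`F̂_{y k,τ}(range (ι k)) = vol⁻¹ · ofReal (∫_{range (ι k)} K_{y k,τ} dμH⁴)`
(`ofReal_integral_eq_lintegral_ofReal`).  By the landed K2 (`helper_kernelIntegralTendstoOfWeakLimit`)
the real integrals converge to `∫ K_{y₀,τ} dμ`, which by the landed K1 (`helper_kernelMassOfProduct`,
`y₀ ∈ N` being a limit of points of the closed set `N`) equals the vertical Gaussian mass
`J_τ = ∫ e^{-(z₅ - (y₀)₅)²/4τ} dμ`.  Hence the densities converge in `ℝ≥0∞` to `vol⁻¹ · ofReal J_τ`, the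
`liminf` is this limit, and the hypothesis reads `1 ≤ vol⁻¹ · ofReal J_τ` for all `τ ∈ (0, 1]`.  As
`τ → 0⁺`, `J_τ → μ.real {z₅ = (y₀)₅}` (`helper_verticalGaussianMassTendsto`), so
`1 ≤ vol⁻¹ · μ {z₅ = (y₀)₅}`, i.e. `vol ≤ μ {z₅ = (y₀)₅}` (`0 < vol < ∞`).

Everything here is PROVED (no `sorry`, no definitions, no named facts).

References: K. A. Brakke, *The motion of a surface by its mean curvature* (1978), §3 (densities of
limit measures); P. Billingsley, *Convergence of probability measures*, 2nd ed. (1999), §2.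
-/

-- the prescribed namespace `Summit.SmoothPoincare4.SmoothPoincare4.…` repeats `SmoothPoincare4`
set_option linter.dupNamespace false

noncomputable section

open Bundle Set Function Filter MeasureTheory Module
open scoped Manifold ContDiff Topology RealInnerProductSpace BigOperators ENNReal NNReal

namespace Summit.SmoothPoincare4.SmoothPoincare4.Cruxes.CylinderRungTwo.KillingFlux

open Literature.Geometry.Riemannian Literature.Geometry.Riemannian.SphericalCylinderConformal
open Literature.Geometry.Riemannian.SphericalCylinderEntropy (cylKernel cylDensity truncL
  abs_cylKernel_le_majorant hausdorffMeasure_sphere_four_pos hausdorffMeasure_sphere_four_lt_top)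

namespace AtomOfLiminfDensity

/-! ## Elementary pieces -/

/-- The round cylinder `N = {∑_{i<5} zᵢ² = 1} ⊂ ℝ⁶` is closed, so a limit of centres `y k ∈ N` lies
in `N`. [folklore] -/
theorem sum_sq_eq_one_of_tendsto {y : ℕ → EuclideanSpace ℝ (Fin 6)} {y₀ : EuclideanSpace ℝ (Fin 6)}
    (hyN : ∀ k, ∑ i : Fin 5, y k (Fin.castSucc i) ^ 2 = 1) (hy : Tendsto y atTop (𝓝 y₀)) :
    ∑ i : Fin 5, y₀ (Fin.castSucc i) ^ 2 = 1 := by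
  have hclosed : IsClosed {p : EuclideanSpace ℝ (Fin 6) | ∑ i : Fin 5, p (Fin.castSucc i) ^ 2 = 1} :=
    isClosed_eq (by fun_prop) continuous_const
  exact hclosed.mem_of_tendsto hy (Eventually.of_forall hyN)

/-- A measure carried by the slab `{∑_{i<5} zᵢ² = 1, |z₅| ≤ B}` is carried by the cylinder
`N = {∑_{i<5} zᵢ² = 1}`. [folklore] -/
theorem measure_not_mem_cylinder_eq_zero {μ : Measure (EuclideanSpace ℝ (Fin 6))} {B : ℝ}
    (hμC : μ {z : EuclideanSpace ℝ (Fin 6) |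
      ¬ (∑ i : Fin 5, z (Fin.castSucc i) ^ 2 = 1 ∧ |z 5| ≤ B)} = 0) :
    μ {z : EuclideanSpace ℝ (Fin 6) | ¬ (∑ i : Fin 5, z (Fin.castSucc i) ^ 2 = 1)} = 0 := by
  refine measure_mono_null ?_ hμC
  intro z hz h
  exact hz h.1

/-- **The typed kernel is integrable on a finite-area measurable subset of `N`** (it is continuous,
and bounded on `N × N` at a fixed scale, `abs_cylKernel_le_majorant`). [folklore] -/
theorem integrableOn_cylKernel {A : Set (EuclideanSpace ℝ (Fin 6))} (hAm : MeasurableSet A)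
    (hAN : ∀ z ∈ A, ∑ i : Fin 5, z (Fin.castSucc i) ^ 2 = 1)
    (hA : (μH[4] : Measure (EuclideanSpace ℝ (Fin 6))) A ≠ ⊤)
    {p : EuclideanSpace ℝ (Fin 6)} (hp : ∑ i : Fin 5, p (Fin.castSucc i) ^ 2 = 1)
    {τ : ℝ} (hτ : 0 < τ) :
    IntegrableOn (fun z => cylKernel p τ z) A (μH[4] : Measure (EuclideanSpace ℝ (Fin 6))) :=
  Measure.integrableOn_of_bounded hA (continuous_cylKernel p hτ).aestronglyMeasurable
    (ae_restrict_of_forall_mem hAm fun z hz => by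
      rw [Real.norm_eq_abs]
      exact abs_cylKernel_le_majorant hp (hAN z hz) hτ le_rfl)

/-- **The typed density as a real integral**: for a finite-area measurable `A ⊆ N`, a centre `p ∈ N`
and `τ > 0`, `F̂_{p,τ}(A) = vol⁻¹ · ofReal (∫_A K_{p,τ} dμH⁴)` (the kernel is `≥ 0` on `N` and
integrable on `A`, `ofReal_integral_eq_lintegral_ofReal`). [folklore] -/
theorem cylDensity_eq_inv_mul_ofReal_setIntegral {A : Set (EuclideanSpace ℝ (Fin 6))}
    (hAm : MeasurableSet A) (hAN : ∀ z ∈ A, ∑ i : Fin 5, z (Fin.castSucc i) ^ 2 = 1)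
    (hA : (μH[4] : Measure (EuclideanSpace ℝ (Fin 6))) A ≠ ⊤)
    {p : EuclideanSpace ℝ (Fin 6)} (hp : ∑ i : Fin 5, p (Fin.castSucc i) ^ 2 = 1)
    {τ : ℝ} (hτ : 0 < τ) :
    cylDensity A p τ = (μH[4] (Metric.sphere (0 : EuclideanSpace ℝ (Fin 5)) 1))⁻¹ *
      ENNReal.ofReal (∫ z in A, cylKernel p τ z ∂(μH[4] : Measure (EuclideanSpace ℝ (Fin 6)))) := by
  rw [cylDensity, ofReal_integral_eq_lintegral_ofReal (integrableOn_cylKernel hAm hAN hA hp hτ)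
    (ae_restrict_of_forall_mem hAm fun z hz => cylKernel_nonneg_of_mem hp (hAN z hz) hτ)]

/-- `ℝ≥0∞` algebra: for `0 < v < ∞`, `1 ≤ v⁻¹ * m` gives `v ≤ m`. [folklore] -/
theorem le_of_one_le_inv_mul {v m : ℝ≥0∞} (hv0 : v ≠ 0) (hvt : v ≠ ⊤) (h : 1 ≤ v⁻¹ * m) :
    v ≤ m :=
  calc v = v * 1 := (mul_one v).symm
    _ ≤ v * (v⁻¹ * m) := by gcongr
    _ = m := by rw [← mul_assoc, ENNReal.mul_inv_cancel hv0 hvt, one_mul]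

end AtomOfLiminfDensity

open AtomOfLiminfDensity

/-- **Registered helper `helper_atomOfLiminfDensity` of line `killing-flux` (lead c4, relaxation up to
multiplicity, A1').**  For smooth embeddings `ι k : M → N ⊂ ℝ⁶` of a compact `4`-manifold with heights
`|z₅| ≤ B`, a finite measure `μ` carried by `N ∩ {|z₅| ≤ B}` with the product property and
`μH⁴ ⌊ range (ι k) ⇀ μ` weakly, centres `y k ∈ N` with `y k → y₀`, and unit lower density
`1 ≤ liminf_k F̂_{y k,τ}(range (ι k))` for all `τ ∈ (0, 1]`, the limit height carries an atom of weight
at least `vol(S⁴)`: `μH⁴(S⁴) ≤ μ {z | z₅ = (y₀)₅}` (K2: the kernel integrals converge to `∫ K_{y₀,τ} dμ`;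
K1: this is the vertical Gaussian mass `∫ e^{-(z₅ - (y₀)₅)²/4τ} dμ`, which tends to `μ{z₅ = (y₀)₅}` as
`τ → 0⁺`). [folklore] -/
theorem helper_atomOfLiminfDensity : ∀ (M : Type) [TopologicalSpace M] [T2Space M] [SecondCountableTopology M] [ChartedSpace (EuclideanSpace ℝ (Fin 4)) M] [IsManifold (𝓡 4) ∞ M] [CompactSpace M] (ι : ℕ → M → EuclideanSpace ℝ (Fin 6)), (∀ k, Manifold.IsSmoothEmbedding (𝓡 4) (𝓡 6) ∞ (ι k)) → (∀ k x, ∑ i : Fin 5, ι k x (Fin.castSucc i) ^ 2 = 1) → ∀ B : ℝ, (∀ k x, |ι k x 5| ≤ B) → ∀ (μ : Measure (EuclideanSpace ℝ (Fin 6))) [IsFiniteMeasure μ], μ {z : EuclideanSpace ℝ (Fin 6) | ¬ (∑ i : Fin 5, z (Fin.castSucc i) ^ 2 = 1 ∧ |z 5| ≤ B)} = 0 → (∀ Φ : ℝ → ℝ, Continuous Φ → ∀ g : EuclideanSpace ℝ (Fin 5) → ℝ, Continuous g → ∫ z, Φ (z 5) * g (Literature.Geometry.Riemannian.SphericalCylinderEntropy.truncL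 z) ∂μ = ((μH[4] (Metric.sphere (0 : EuclideanSpace ℝ (Fin 5)) 1)).toReal)⁻¹ * (∫ y in Metric.sphere (0 : EuclideanSpace ℝ (Fin 5)) 1, g y ∂(μH[4] : Measure (EuclideanSpace ℝ (Fin 5)))) * ∫ z, Φ (z 5) ∂μ) → (∀ g : BoundedContinuousFunction (EuclideanSpace ℝ (Fin 6)) ℝ, Filter.Tendsto (fun k => ∫ z in Set.range (ι k), g z ∂(μH[4] : Measure (EuclideanSpace ℝ (Fin 6)))) Filter.atTop (𝓝 (∫ z, g z ∂μ))) → ∀ (y : ℕ → EuclideanSpace ℝ (Fin 6)) (y₀ : EuclideanSpace ℝ (Fin 6)), (∀ k, ∑ i : Fin 5, y k (Fin.castSucc i) ^ 2 = 1) → Filter.Tendsto y Filter.atTop (𝓝 y₀) → (∀ τ : ℝ, 0 < τ → τ ≤ 1 → 1 ≤ Filter.liminf (fun k => Literature.Geometry.Riemannian.SphericalCylinderEntropy.cylDensity (Set.range (ι k)) (y k) τ) Filter.atTop) → μH[4] (Metric.sphere (0 : EuclideanSpace ℝ (Fin 5)) 1) ≤ μ {z : EuclideanSpace ℝ (Fin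 6) | z 5 = y₀ 5} := by
  intro M _ _ _ _ _ _ ι hemb hN B hB μ _ hμC hprod hweak y y₀ hyN hy hdens
  -- Step 0: the limit centre lies on `N`, `μ` is carried by `N`, and `0 < vol < ∞`
  have hy₀N : ∑ i : Fin 5, y₀ (Fin.castSucc i) ^ 2 = 1 := sum_sq_eq_one_of_tendsto hyN hy
  have hμN : μ {z : EuclideanSpace ℝ (Fin 6) | ¬ (∑ i : Fin 5, z (Fin.castSucc i) ^ 2 = 1)} = 0 :=
    measure_not_mem_cylinder_eq_zero hμC
  have hv0 : μH[4] (Metric.sphere (0 : EuclideanSpace ℝ (Fin 5)) 1) ≠ 0 :=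
    hausdorffMeasure_sphere_four_pos.ne'
  have hvt : μH[4] (Metric.sphere (0 : EuclideanSpace ℝ (Fin 5)) 1) ≠ ⊤ :=
    hausdorffMeasure_sphere_four_lt_top.ne
  have hvinv : (μH[4] (Metric.sphere (0 : EuclideanSpace ℝ (Fin 5)) 1))⁻¹ ≠ ⊤ :=
    ENNReal.inv_ne_top.2 hv0
  -- Step 1: the images are measurable subsets of `N` of finite area
  have hfin : ∀ k, (μH[4] : Measure (EuclideanSpace ℝ (Fin 6))) (Set.range (ι k)) ≠ ⊤ := fun k =>
    (Literature.MeasureTheory.Hausdorff.hausdorffMeasure_range_lt_top (E := EuclideanSpace ℝ (Fin 4))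
      (I := 𝓡 4) (hemb k).contMDiff (by simp) (d := 4) (by simp)).ne
  have hmeas : ∀ k, MeasurableSet (Set.range (ι k)) := fun k =>
    (isCompact_range (hemb k).isEmbedding.continuous).isClosed.measurableSet
  have hrangeN : ∀ k, ∀ z ∈ Set.range (ι k), ∑ i : Fin 5, z (Fin.castSucc i) ^ 2 = 1 := fun k => by
    rintro _ ⟨x, rfl⟩
    exact hN k x
  -- Step 2: for every `τ ∈ (0, 1]`, `1 ≤ vol⁻¹ · ofReal (∫ e^{-(z₅ - (y₀)₅)²/4τ} dμ)`
  have hkey : ∀ τ : ℝ, 0 < τ → τ ≤ 1 →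
      1 ≤ (μH[4] (Metric.sphere (0 : EuclideanSpace ℝ (Fin 5)) 1))⁻¹ *
        ENNReal.ofReal (∫ z, Real.exp (-((z 5 - y₀ 5) ^ 2) / (4 * τ)) ∂μ) := by
    intro τ hτ hτ1
    -- K2: the kernel integrals with moving centres converge to `∫ K_{y₀,τ} dμ`
    have hK2 := helper_kernelIntegralTendstoOfWeakLimit M ι hemb hN B hB μ hμC hweak y y₀ hyN hy τ hτ
    -- K1: `∫ K_{y₀,τ} dμ` is the vertical Gaussian mass
    rw [helper_kernelMassOfProduct μ hμN hprod y₀ hy₀N τ hτ] at hK2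
    -- the densities as real integrals
    have hfun : (fun k => cylDensity (Set.range (ι k)) (y k) τ) = fun k =>
        (μH[4] (Metric.sphere (0 : EuclideanSpace ℝ (Fin 5)) 1))⁻¹ *
          ENNReal.ofReal (∫ z in Set.range (ι k), cylKernel (y k) τ z
            ∂(μH[4] : Measure (EuclideanSpace ℝ (Fin 6)))) :=
      funext fun k => cylDensity_eq_inv_mul_ofReal_setIntegral (hmeas k) (hrangeN k) (hfin k)
        (hyN k) hτ
    have hlim : Tendsto (fun k => cylDensity (Set.range (ι k)) (y k) τ) atTop
        (𝓝 ((μH[4] (Metric.sphere (0 : EuclideanSpace ℝ (Fin 5)) 1))⁻¹ *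
          ENNReal.ofReal (∫ z, Real.exp (-((z 5 - y₀ 5) ^ 2) / (4 * τ)) ∂μ))) := by
      rw [hfun]
      exact ENNReal.Tendsto.const_mul (ENNReal.tendsto_ofReal hK2) (Or.inr hvinv)
    have h := hdens τ hτ hτ1
    rwa [hlim.liminf_eq] at h
  -- Step 3: let `τ → 0⁺` (K1: the vertical Gaussian mass tends to the mass of the slice)
  have hlim₀ : Tendsto (fun τ : ℝ => (μH[4] (Metric.sphere (0 : EuclideanSpace ℝ (Fin 5)) 1))⁻¹ *
      ENNReal.ofReal (∫ z, Real.exp (-((z 5 - y₀ 5) ^ 2) / (4 * τ)) ∂μ)) (𝓝[>] 0)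
      (𝓝 ((μH[4] (Metric.sphere (0 : EuclideanSpace ℝ (Fin 5)) 1))⁻¹ *
        ENNReal.ofReal (μ.real {z : EuclideanSpace ℝ (Fin 6) | z 5 = y₀ 5}))) :=
    ENNReal.Tendsto.const_mul (ENNReal.tendsto_ofReal (helper_verticalGaussianMassTendsto μ (y₀ 5)))
      (Or.inr hvinv)
  have hge : 1 ≤ (μH[4] (Metric.sphere (0 : EuclideanSpace ℝ (Fin 5)) 1))⁻¹ *
      ENNReal.ofReal (μ.real {z : EuclideanSpace ℝ (Fin 6) | z 5 = y₀ 5}) := by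
    refine ge_of_tendsto hlim₀ ?_
    filter_upwards [Ioc_mem_nhdsGT (zero_lt_one' ℝ)] with τ hτ using hkey τ hτ.1 hτ.2
  rw [measureReal_def, ENNReal.ofReal_toReal (measure_ne_top μ _)] at hge
  -- Step 4: `1 ≤ vol⁻¹ · μ S` gives `vol ≤ μ S`
  exact le_of_one_le_inv_mul hv0 hvt hge

end Summit.SmoothPoincare4.SmoothPoincare4.Cruxes.CylinderRungTwo.KillingFlux

end
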